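import Summits.Ventures.HSemireg.WeilFrameMukaiPairing
import Summits.Ventures.HSemireg.Mod4TwoSlopeSpectrumGeneral

/-!
# Venture HSemireg — THEOREM R₂ ON THE REAL CARRIER: the TWO-SLOPE classes `v = A e^{λh} + B e^{μh} + w` on a Weil-type `2n`-fold,
# every `n` — side degrees `4C(2n,m) − 4C(n,m)`, middle degree `4C(2n,n) − 4` generically and `4C(2n,n) − 6` on the BOX LOCUS
# `t = AB(λ−μ)^{2n}`, and the Mukai density `((2AB(λ−μ)^{2n} + 2(−1)ⁿt)/(2n)!)·ĥ^{2n}`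

HONEST FRAMING. Part of the Lean index of the computation cell `pub-hsemireg` (seat w3-mod4-1 gen 9, W3 SPECIAL FIBRES;
MOD4-OFFSPLIT (E21)/(E22) THEOREM R₂, TABLE R row «ρ(f) = 2: generic `P_n(t)² + 2tⁿ`, `P_n(t)²` exactly on the locus
`∫w² = (f,f)_χ`»). The tree's real carriers and the Literature's Weil-type layer ONLY: no semiregularity map, no Ext group, no `∫`;
nothing here says that HC / HC_CM / HC_AV holds; nothing here is a claim about any explicit variety; no Literature fact is declared;
NO definition is introduced (the two-slope sequence `q_m = Aλ^m + Bμ^m` is written out). THIS FILE DOES NOT NEED the unbuilt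
`Mod4Carrier*` modules (imports: FILE 20 and the pure matrix file `Mod4TwoSlopeSpectrumGeneral`).

WHAT IS PROVED, for `A : AbelianVariety ℂ` of dimension `2n` (`n ≥ 1`), `φ ≫ φ = -(d • 𝟙 A)`, `d ≥ 1`, `P, Q` the
`±i√d`-eigenspaces, `dim (P ⊓ H^{1,0}) = n`, `h` `K`-symmetric of type `(1,1)` with `ĥ^{2n} ≠ 0`, non-zero `c± ∈ E±`, the class
`x = Σ_{m ≤ 2n} (q_m/m!) ĥ^m + ĉ₊ + ĉ₋` with `q_m = Aλ^m + Bμ^m`, `A, B ≠ 0`, `λ ≠ μ` («two distinct slopes»), and the pin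
`(2n)!·(ĉ₊ĉ₋) = t·ĥ^{2n}`:
* `pin_ne_zero_weilDatum` / `pin_ne_zero_weilType` — the pin `t` is non-zero (`t = (-1)ⁿab` in a frame);
* **`finrank_S_twoSlope_deg`** — `dim S_m(x) + 4C(n,m) = 4C(2n,m)` for `1 ≤ m ≤ n - 1` (`r_m = 2` by `Mod4.hankel1_rank_twoSlope`);
* **`finrank_S_twoSlope_middle_box`** — on the BOX LOCUS `t = AB(λ-μ)^{2n}`: `dim S_n(x) + 6 = 4C(2n,n)`;
* **`finrank_S_twoSlope_middle_generic`** — off it: `dim S_n(x) + 4 = 4C(2n,n)`;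
* **`proj_mukaiDual_mul_top_twoSlope`** — the degree-`4n` part of `x^∨ · x` is `((2AB(λ-μ)^{2n} + 2(-1)ⁿ t)/(2n)!) · ĥ^{2n}`, so the
  box locus is EXACTLY «`P_f(q) = 2AB(λ-μ)^{2n} = 2t`», i.e. (under the reading `∫ĥ^{2n} = (2n)!·D`) «`(f,f)_χ = ∫w²`» — TABLE R's
  locus sentence, for every `n`.
(At `n = 3`: `R = (1, 12, 48, 76, 48, 12, 1)` generically and `(1, 12, 48, 74, 48, 12, 1)` on the box locus — the sheet's
`P₃(t)² + 2t³` / `P₃(t)²`; the upper degrees follow from FILE 15 once its imports are built.) Everything PROVED, 0 sorry.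
References: [BuchweitzFlenner2008HH] Prop. 6.4.4; [vanGeemen1994HodgeAV] 4.9, Lemma 5.2; [BourbakiAlgebre1a3] Ch. III §8, §11 no. 9.
-/

noncomputable section

open CliffordAlgebra (contractLeft)
open ExteriorAlgebra (ι)
open Module CategoryTheory
open Literature.AlgebraicGeometry.Motives Literature.AlgebraicGeometry.HodgeTheory
open Literature.AlgebraicTopology.SingularHomology

namespace Summit.Ventures.HSemireg.WeilFrame

open Summit.Ventures.HSemireg.WedgeBridge Summit.Ventures.HSemireg.WeilCarrier Summit.Ventures.HSemireg.Mod4Carrier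
open Summit.Ventures.HSemireg.Wedge.Hankel

/-! ### 1. The pin is non-zero -/

section Datum

variable {K : Type*} [Field K] {V : Type*} [AddCommGroup V] [Module K V]

/-- **the pin is non-zero:** for a Weil datum of type `(n,n)` with non-zero Weil vectors, `(2n)!·(w₊ w₋) = t·Θ^{2n}` forces
`t ≠ 0` (`t = (-1)ⁿab` in an adapted frame, `a, b ≠ 0`). [cite: BourbakiAlgebre1a3, Ch. III §7 no. 8] -/
theorem pin_ne_zero_weilDatum [FiniteDimensional K V] [CharZero K] {n : ℕ} {L P Q : Submodule K V}
    {Θ wP wQ : ExteriorAlgebra K V} (hV : finrank K V = (n + n) + (n + n)) (hPQ : Disjoint P Q)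
    (hL : finrank K L = n + n) (hLQ : finrank K ↥(L ⊓ Q) = n) (hLP : finrank K ↥(L ⊓ P) = n)
    (hP : finrank K ↥P = n + n) (hQ : finrank K ↥Q = n + n) (hΘ : Θ ∈ Submodule.span K
      {z : ExteriorAlgebra K V | ∃ x l : V, ((x ∈ P ∧ l ∈ L ⊓ Q) ∨ (x ∈ Q ∧ l ∈ L ⊓ P)) ∧ z = ι K x * ι K l})
    (hnd : ∀ l ∈ (L : Set V), ι K l ∈ Submodule.span K {y : ExteriorAlgebra K V |
      ∃ φ ∈ {θ : Module.Dual K V | ∀ q ∈ L, θ q = 0}, y = contractLeft φ Θ})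
    (hwP : wP ∈ ((⋀[K]^(finrank K ↥P) ↥P).map (ExteriorAlgebra.map P.subtype).toLinearMap)) (hwP0 : wP ≠ 0)
    (hwQ : wQ ∈ ((⋀[K]^(finrank K ↥Q) ↥Q).map (ExteriorAlgebra.map Q.subtype).toLinearMap)) (hwQ0 : wQ ≠ 0)
    {t : K} (ht : (((n + n).factorial : ℕ) : K) • (wP * wQ) = t • Θ ^ (n + n)) : t ≠ 0 := by
  obtain ⟨bV, a, b, ha, hb, -, hT, rfl, rfl, -⟩ :=
    exists_frame_of_weilDatum hV hPQ hL hLQ hLP hP hQ hΘ hnd hwP hwP0 hwQ hwQ0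
  have hfac : (((n + n).factorial : ℕ) : K) ≠ 0 := Nat.cast_ne_zero.mpr (Nat.factorial_ne_zero _)
  have ht' : (a • wUp bV n) * (b • wLow bV n) = t • LMprod bV (n + n) := by
    apply smul_right_injective (ExteriorAlgebra K V) hfac
    dsimp only
    rw [ht, smul_comm, factorial_smul_LMprod_eq_pow, hT]
  rw [eq_of_smul_wUp_mul_smul_wLow bV (Nat.le_add_right n n) ht']
  exact mul_ne_zero (pow_ne_zero _ (neg_ne_zero.mpr one_ne_zero)) (mul_ne_zero ha hb)

end Datum

section RealCarrier

variable {A : AbelianVariety ℂ}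

/-- **the pin is non-zero on the real carrier:** `(2n)!·(ĉ₊ĉ₋) = t·ĥ^{2n}` with non-zero Weil classes forces `t ≠ 0`.
[cite: vanGeemen1994HodgeAV, 4.9] -/
theorem pin_ne_zero_weilType (hA : IsSmoothProjective A.dim A.X) {n d : ℕ} (hdim : A.dim = n + n) (hd : 0 < d)
    {φ : A ⟶ A} (hφ : φ ≫ φ = -(d • 𝟙 A)) {P Q : Submodule ℂ (complexBetti A.X 1)}
    (hP : P = Module.End.eigenspace (complexBetti.map φ.hom.hom.hom 1).hom (Complex.I * (Real.sqrt d : ℂ)))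
    (hQ : Q = Module.End.eigenspace (complexBetti.map φ.hom.hom.hom 1).hom (-(Complex.I * (Real.sqrt d : ℂ))))
    (hp : finrank ℂ ↥(P ⊓ hodgeOneZero hA) = n) {h : complexBetti A.X 2}
    (hh : complexBetti.map φ.hom.hom.hom 2 h = (d : ℂ) • h) (h11 : IsOfHodgeType A.dim A.X 2 1 1 h)
    (hvol : ((⋀[ℂ]^2 (complexBetti A.X 1)).subtype ((abelianVarietyCohomologyExteriorH1_holds.equiv A 2).symm h)) ^ (n + n) ≠ 0)
    {cP cQ : complexBetti A.X (2 * n)} (hcP : cP ∈ weilClassesPlus A φ n d) (hcP0 : cP ≠ 0)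
    (hcQ : cQ ∈ weilClassesMinus A φ n d) (hcQ0 : cQ ≠ 0) {t : ℂ}
    (ht : (((n + n).factorial : ℕ) : ℂ) • ((⋀[ℂ]^(2 * n) (complexBetti A.X 1)).subtype ((abelianVarietyCohomologyExteriorH1_holds.equiv A (2 * n)).symm cP) *
        (⋀[ℂ]^(2 * n) (complexBetti A.X 1)).subtype ((abelianVarietyCohomologyExteriorH1_holds.equiv A (2 * n)).symm cQ)) =
      t • ((⋀[ℂ]^2 (complexBetti A.X 1)).subtype ((abelianVarietyCohomologyExteriorH1_holds.equiv A 2).symm h)) ^ (n + n)) : t ≠ 0 := by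
  haveI : Module.Finite ℂ (complexBetti A.X 1) := abelianVarietyCohomologyExteriorH1_holds.finite_one A
  obtain ⟨hV, hPQ, hL, hLQ, hLP, hP2, hQ2⟩ := weilBlocks_of_sq_eq_neg hA hdim hd hφ hP hQ hp
  exact pin_ne_zero_weilDatum hV hPQ hL hLQ hLP hP2 hQ2 (exteriorOf_mem_span_weilGen hA hd hφ hP hQ hh h11)
    (hnd_of_polarisation_pow_ne_zero hA hdim hd hφ hP hQ hh h11 hvol)
    (exteriorOf_mem_topLine_of_mem_weilClassesPlus hdim hd hφ hP hcP) (exteriorOf_ne_zero hcP0)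
    (exteriorOf_mem_topLine_of_mem_weilClassesMinus hdim hd hφ hQ hcQ) (exteriorOf_ne_zero hcQ0) ht

/-- **THEOREM R₂, lower side degrees on the real carrier** (`1 ≤ m ≤ n - 1`): for the two-slope h-part `q_m = Aλ^m + Bμ^m`
(`A, B ≠ 0`, `λ ≠ μ`): `dim S_m(x) + 4C(n,m) = 4C(2n,m)` (`r_m = 2`). [cite: BuchweitzFlenner2008HH, Prop. 6.4.4] -/
theorem finrank_S_twoSlope_deg (hA : IsSmoothProjective A.dim A.X) {n d : ℕ} (hdim : A.dim = n + n) (hd : 0 < d)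
    {φ : A ⟶ A} (hφ : φ ≫ φ = -(d • 𝟙 A)) {P Q : Submodule ℂ (complexBetti A.X 1)}
    (hP : P = Module.End.eigenspace (complexBetti.map φ.hom.hom.hom 1).hom (Complex.I * (Real.sqrt d : ℂ)))
    (hQ : Q = Module.End.eigenspace (complexBetti.map φ.hom.hom.hom 1).hom (-(Complex.I * (Real.sqrt d : ℂ))))
    (hp : finrank ℂ ↥(P ⊓ hodgeOneZero hA) = n) {h : complexBetti A.X 2}
    (hh : complexBetti.map φ.hom.hom.hom 2 h = (d : ℂ) • h) (h11 : IsOfHodgeType A.dim A.X 2 1 1 h)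
    (hvol : ((⋀[ℂ]^2 (complexBetti A.X 1)).subtype ((abelianVarietyCohomologyExteriorH1_holds.equiv A 2).symm h)) ^ (n + n) ≠ 0)
    {cP cQ : complexBetti A.X (2 * n)} (hcP : cP ∈ weilClassesPlus A φ n d) (hcP0 : cP ≠ 0)
    (hcQ : cQ ∈ weilClassesMinus A φ n d) (hcQ0 : cQ ≠ 0)
    {Aₛ Bₛ la mu : ℂ} (hAs : Aₛ ≠ 0) (hBs : Bₛ ≠ 0) (hlm : la ≠ mu) {m : ℕ} (hm1 : 1 ≤ m) (hmn : m + 1 ≤ n) :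
    finrank ℂ ↥(S ℂ (hodgeZeroOne hA) m
        ((∑ m ∈ Finset.range (n + n + 1), ((Aₛ * la ^ m + Bₛ * mu ^ m) * ((m.factorial : ℕ) : ℂ)⁻¹) •
            ((⋀[ℂ]^2 (complexBetti A.X 1)).subtype ((abelianVarietyCohomologyExteriorH1_holds.equiv A 2).symm h)) ^ m) +
          (⋀[ℂ]^(2 * n) (complexBetti A.X 1)).subtype ((abelianVarietyCohomologyExteriorH1_holds.equiv A (2 * n)).symm cP) +
          (⋀[ℂ]^(2 * n) (complexBetti A.X 1)).subtype ((abelianVarietyCohomologyExteriorH1_holds.equiv A (2 * n)).symm cQ))) + 4 * n.choose m = 4 * (n + n).choose m := by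
  haveI : Module.Finite ℂ (complexBetti A.X 1) := abelianVarietyCohomologyExteriorH1_holds.finite_one A
  have h : finrank ℂ ↥(S ℂ (hodgeZeroOne hA) m
        ((∑ m ∈ Finset.range (n + n + 1), ((Aₛ * la ^ m + Bₛ * mu ^ m) * ((m.factorial : ℕ) : ℂ)⁻¹) •
            ((⋀[ℂ]^2 (complexBetti A.X 1)).subtype ((abelianVarietyCohomologyExteriorH1_holds.equiv A 2).symm h)) ^ m) +
          (⋀[ℂ]^(2 * n) (complexBetti A.X 1)).subtype ((abelianVarietyCohomologyExteriorH1_holds.equiv A (2 * n)).symm cP) +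
          (⋀[ℂ]^(2 * n) (complexBetti A.X 1)).subtype ((abelianVarietyCohomologyExteriorH1_holds.equiv A (2 * n)).symm cQ))) +
        (n.choose m + n.choose m) * (hankel1 ℂ (n + n) m (fun m => Aₛ * la ^ m + Bₛ * mu ^ m)).rank =
      (n + n).choose m + (n + n).choose m + (n + n).choose m * (hankel1 ℂ (n + n) m (fun m => Aₛ * la ^ m + Bₛ * mu ^ m)).rank :=
    finrank_S_weilType_deg hA hdim hd hφ hP hQ hp hh h11 hvol hcP hcP0 hcQ hcQ0 (fun m => Aₛ * la ^ m + Bₛ * mu ^ m) hm1 hmn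
  rw [Mod4.hankel1_rank_twoSlope hm1 (by omega) hAs hBs hlm] at h
  omega

/-- **THEOREM R₂, middle degree ON THE BOX LOCUS** `t = AB(λ-μ)^{2n}`: `dim S_n(x) + 6 = 4C(2n,n)` (`r_n = 2`, the
`t`-eigenspace of `M_f(q)` is a plane). [cite: BuchweitzFlenner2008HH, Prop. 6.4.4] -/
theorem finrank_S_twoSlope_middle_box (hA : IsSmoothProjective A.dim A.X) {n d : ℕ} (hdim : A.dim = n + n) (hd : 0 < d)
    {φ : A ⟶ A} (hφ : φ ≫ φ = -(d • 𝟙 A)) {P Q : Submodule ℂ (complexBetti A.X 1)}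
    (hP : P = Module.End.eigenspace (complexBetti.map φ.hom.hom.hom 1).hom (Complex.I * (Real.sqrt d : ℂ)))
    (hQ : Q = Module.End.eigenspace (complexBetti.map φ.hom.hom.hom 1).hom (-(Complex.I * (Real.sqrt d : ℂ))))
    (hp : finrank ℂ ↥(P ⊓ hodgeOneZero hA) = n) {h : complexBetti A.X 2}
    (hh : complexBetti.map φ.hom.hom.hom 2 h = (d : ℂ) • h) (h11 : IsOfHodgeType A.dim A.X 2 1 1 h)
    (hvol : ((⋀[ℂ]^2 (complexBetti A.X 1)).subtype ((abelianVarietyCohomologyExteriorH1_holds.equiv A 2).symm h)) ^ (n + n) ≠ 0)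
    {cP cQ : complexBetti A.X (2 * n)} (hcP : cP ∈ weilClassesPlus A φ n d) (hcP0 : cP ≠ 0)
    (hcQ : cQ ∈ weilClassesMinus A φ n d) (hcQ0 : cQ ≠ 0)
    {Aₛ Bₛ la mu : ℂ} (hAs : Aₛ ≠ 0) (hBs : Bₛ ≠ 0) (hlm : la ≠ mu) (hn : 1 ≤ n)
    (ht : (((n + n).factorial : ℕ) : ℂ) • ((⋀[ℂ]^(2 * n) (complexBetti A.X 1)).subtype ((abelianVarietyCohomologyExteriorH1_holds.equiv A (2 * n)).symm cP) *
        (⋀[ℂ]^(2 * n) (complexBetti A.X 1)).subtype ((abelianVarietyCohomologyExteriorH1_holds.equiv A (2 * n)).symm cQ)) =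
      (Aₛ * Bₛ * (la - mu) ^ (n + n)) • ((⋀[ℂ]^2 (complexBetti A.X 1)).subtype ((abelianVarietyCohomologyExteriorH1_holds.equiv A 2).symm h)) ^ (n + n)) :
    finrank ℂ ↥(S ℂ (hodgeZeroOne hA) n
        ((∑ m ∈ Finset.range (n + n + 1), ((Aₛ * la ^ m + Bₛ * mu ^ m) * ((m.factorial : ℕ) : ℂ)⁻¹) •
            ((⋀[ℂ]^2 (complexBetti A.X 1)).subtype ((abelianVarietyCohomologyExteriorH1_holds.equiv A 2).symm h)) ^ m) +
          (⋀[ℂ]^(2 * n) (complexBetti A.X 1)).subtype ((abelianVarietyCohomologyExteriorH1_holds.equiv A (2 * n)).symm cP) +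
          (⋀[ℂ]^(2 * n) (complexBetti A.X 1)).subtype ((abelianVarietyCohomologyExteriorH1_holds.equiv A (2 * n)).symm cQ))) + 6 = 4 * (n + n).choose n := by
  haveI : Module.Finite ℂ (complexBetti A.X 1) := abelianVarietyCohomologyExteriorH1_holds.finite_one A
  have h : finrank ℂ ↥(S ℂ (hodgeZeroOne hA) n
        ((∑ m ∈ Finset.range (n + n + 1), ((Aₛ * la ^ m + Bₛ * mu ^ m) * ((m.factorial : ℕ) : ℂ)⁻¹) •
            ((⋀[ℂ]^2 (complexBetti A.X 1)).subtype ((abelianVarietyCohomologyExteriorH1_holds.equiv A 2).symm h)) ^ m) +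
          (⋀[ℂ]^(2 * n) (complexBetti A.X 1)).subtype ((abelianVarietyCohomologyExteriorH1_holds.equiv A (2 * n)).symm cP) +
          (⋀[ℂ]^(2 * n) (complexBetti A.X 1)).subtype ((abelianVarietyCohomologyExteriorH1_holds.equiv A (2 * n)).symm cQ))) +
        2 * (hankel1 ℂ (n + n) n (fun m => Aₛ * la ^ m + Bₛ * mu ^ m)).rank +
        finrank ℂ ↥(LinearMap.ker (Matrix.toLin' (Mod4.middleM n (fun m => Aₛ * la ^ m + Bₛ * mu ^ m)) - (Aₛ * Bₛ * (la - mu) ^ (n + n)) • LinearMap.id)) =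
      ((hankel1 ℂ (n + n) n (fun m => Aₛ * la ^ m + Bₛ * mu ^ m)).rank + 2) * (n + n).choose n :=
    finrank_S_weilType_middle hA hdim hd hφ hP hQ hp hh h11 hvol hcP hcP0 hcQ hcQ0 hn (fun m => Aₛ * la ^ m + Bₛ * mu ^ m) ht
  rw [Mod4.hankel1_rank_twoSlope hn (by omega) hAs hBs hlm, Mod4.finrank_ker_middleM_twoSlope_box hn hAs hBs hlm] at h
  omega

/-- **THEOREM R₂, middle degree OFF THE BOX LOCUS** (`t ≠ AB(λ-μ)^{2n}`; `t ≠ 0` is automatic): `dim S_n(x) + 4 = 4C(2n,n)`.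
[cite: BuchweitzFlenner2008HH, Prop. 6.4.4] -/
theorem finrank_S_twoSlope_middle_generic (hA : IsSmoothProjective A.dim A.X) {n d : ℕ} (hdim : A.dim = n + n) (hd : 0 < d)
    {φ : A ⟶ A} (hφ : φ ≫ φ = -(d • 𝟙 A)) {P Q : Submodule ℂ (complexBetti A.X 1)}
    (hP : P = Module.End.eigenspace (complexBetti.map φ.hom.hom.hom 1).hom (Complex.I * (Real.sqrt d : ℂ)))
    (hQ : Q = Module.End.eigenspace (complexBetti.map φ.hom.hom.hom 1).hom (-(Complex.I * (Real.sqrt d : ℂ))))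
    (hp : finrank ℂ ↥(P ⊓ hodgeOneZero hA) = n) {h : complexBetti A.X 2}
    (hh : complexBetti.map φ.hom.hom.hom 2 h = (d : ℂ) • h) (h11 : IsOfHodgeType A.dim A.X 2 1 1 h)
    (hvol : ((⋀[ℂ]^2 (complexBetti A.X 1)).subtype ((abelianVarietyCohomologyExteriorH1_holds.equiv A 2).symm h)) ^ (n + n) ≠ 0)
    {cP cQ : complexBetti A.X (2 * n)} (hcP : cP ∈ weilClassesPlus A φ n d) (hcP0 : cP ≠ 0)
    (hcQ : cQ ∈ weilClassesMinus A φ n d) (hcQ0 : cQ ≠ 0)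
    {Aₛ Bₛ la mu : ℂ} (hAs : Aₛ ≠ 0) (hBs : Bₛ ≠ 0) (hlm : la ≠ mu) (hn : 1 ≤ n) {t : ℂ}
    (ht : (((n + n).factorial : ℕ) : ℂ) • ((⋀[ℂ]^(2 * n) (complexBetti A.X 1)).subtype ((abelianVarietyCohomologyExteriorH1_holds.equiv A (2 * n)).symm cP) *
        (⋀[ℂ]^(2 * n) (complexBetti A.X 1)).subtype ((abelianVarietyCohomologyExteriorH1_holds.equiv A (2 * n)).symm cQ)) =
      t • ((⋀[ℂ]^2 (complexBetti A.X 1)).subtype ((abelianVarietyCohomologyExteriorH1_holds.equiv A 2).symm h)) ^ (n + n))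
    (hgen : t ≠ Aₛ * Bₛ * (la - mu) ^ (n + n)) :
    finrank ℂ ↥(S ℂ (hodgeZeroOne hA) n
        ((∑ m ∈ Finset.range (n + n + 1), ((Aₛ * la ^ m + Bₛ * mu ^ m) * ((m.factorial : ℕ) : ℂ)⁻¹) •
            ((⋀[ℂ]^2 (complexBetti A.X 1)).subtype ((abelianVarietyCohomologyExteriorH1_holds.equiv A 2).symm h)) ^ m) +
          (⋀[ℂ]^(2 * n) (complexBetti A.X 1)).subtype ((abelianVarietyCohomologyExteriorH1_holds.equiv A (2 * n)).symm cP) +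
          (⋀[ℂ]^(2 * n) (complexBetti A.X 1)).subtype ((abelianVarietyCohomologyExteriorH1_holds.equiv A (2 * n)).symm cQ))) + 4 = 4 * (n + n).choose n := by
  haveI : Module.Finite ℂ (complexBetti A.X 1) := abelianVarietyCohomologyExteriorH1_holds.finite_one A
  have ht0 := pin_ne_zero_weilType hA hdim hd hφ hP hQ hp hh h11 hvol hcP hcP0 hcQ hcQ0 ht
  have h : finrank ℂ ↥(S ℂ (hodgeZeroOne hA) n
        ((∑ m ∈ Finset.range (n + n + 1), ((Aₛ * la ^ m + Bₛ * mu ^ m) * ((m.factorial : ℕ) : ℂ)⁻¹) •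
            ((⋀[ℂ]^2 (complexBetti A.X 1)).subtype ((abelianVarietyCohomologyExteriorH1_holds.equiv A 2).symm h)) ^ m) +
          (⋀[ℂ]^(2 * n) (complexBetti A.X 1)).subtype ((abelianVarietyCohomologyExteriorH1_holds.equiv A (2 * n)).symm cP) +
          (⋀[ℂ]^(2 * n) (complexBetti A.X 1)).subtype ((abelianVarietyCohomologyExteriorH1_holds.equiv A (2 * n)).symm cQ))) +
        2 * (hankel1 ℂ (n + n) n (fun m => Aₛ * la ^ m + Bₛ * mu ^ m)).rank +
        finrank ℂ ↥(LinearMap.ker (Matrix.toLin' (Mod4.middleM n (fun m => Aₛ * la ^ m + Bₛ * mu ^ m)) - t • LinearMap.id)) =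
      ((hankel1 ℂ (n + n) n (fun m => Aₛ * la ^ m + Bₛ * mu ^ m)).rank + 2) * (n + n).choose n :=
    finrank_S_weilType_middle hA hdim hd hφ hP hQ hp hh h11 hvol hcP hcP0 hcQ hcQ0 hn (fun m => Aₛ * la ^ m + Bₛ * mu ^ m) ht
  rw [Mod4.hankel1_rank_twoSlope hn (by omega) hAs hBs hlm, Mod4.finrank_ker_middleM_twoSlope_generic hn Aₛ Bₛ la mu ht0 hgen] at h
  omega

/-- **Mukai density of a two-slope class on the real carrier:** the degree-`4n` part of `x^∨ · x` is
`((2AB(λ-μ)^{2n} + 2(-1)ⁿ t)/(2n)!) · ĥ^{2n}` — so the box locus `t = AB(λ-μ)^{2n}` is exactly «`P_f(q) = 2t`», i.e. under the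
reading `∫ĥ^{2n} = (2n)!·D` the sheet's «`∫w² = (f,f)_χ`». [cite: MumfordAV1970, §16] [cite: BuchweitzFlenner2008HH, Prop. 6.4.4] -/
theorem proj_mukaiDual_mul_top_twoSlope (hA : IsSmoothProjective A.dim A.X) {n d : ℕ} (hdim : A.dim = n + n) (hd : 0 < d)
    {φ : A ⟶ A} (hφ : φ ≫ φ = -(d • 𝟙 A)) {P Q : Submodule ℂ (complexBetti A.X 1)}
    (hP : P = Module.End.eigenspace (complexBetti.map φ.hom.hom.hom 1).hom (Complex.I * (Real.sqrt d : ℂ)))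
    (hQ : Q = Module.End.eigenspace (complexBetti.map φ.hom.hom.hom 1).hom (-(Complex.I * (Real.sqrt d : ℂ))))
    (hp : finrank ℂ ↥(P ⊓ hodgeOneZero hA) = n) {h : complexBetti A.X 2}
    (hh : complexBetti.map φ.hom.hom.hom 2 h = (d : ℂ) • h) (h11 : IsOfHodgeType A.dim A.X 2 1 1 h)
    (hvol : ((⋀[ℂ]^2 (complexBetti A.X 1)).subtype ((abelianVarietyCohomologyExteriorH1_holds.equiv A 2).symm h)) ^ (n + n) ≠ 0)
    {cP cQ : complexBetti A.X (2 * n)} (hcP : cP ∈ weilClassesPlus A φ n d) (hcP0 : cP ≠ 0)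
    (hcQ : cQ ∈ weilClassesMinus A φ n d) (hcQ0 : cQ ≠ 0)
    (Aₛ Bₛ la mu : ℂ) (hn : 1 ≤ n) {t : ℂ}
    (ht : (((n + n).factorial : ℕ) : ℂ) • ((⋀[ℂ]^(2 * n) (complexBetti A.X 1)).subtype ((abelianVarietyCohomologyExteriorH1_holds.equiv A (2 * n)).symm cP) *
        (⋀[ℂ]^(2 * n) (complexBetti A.X 1)).subtype ((abelianVarietyCohomologyExteriorH1_holds.equiv A (2 * n)).symm cQ)) =
      t • ((⋀[ℂ]^2 (complexBetti A.X 1)).subtype ((abelianVarietyCohomologyExteriorH1_holds.equiv A 2).symm h)) ^ (n + n)) :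
    GradedAlgebra.proj (fun i : ℕ => ⋀[ℂ]^i (complexBetti A.X 1)) ((n + n) + (n + n))
        (((∑ m ∈ Finset.range (n + n + 1), (((-1 : ℂ) ^ m * (Aₛ * la ^ m + Bₛ * mu ^ m)) * ((m.factorial : ℕ) : ℂ)⁻¹) •
              ((⋀[ℂ]^2 (complexBetti A.X 1)).subtype ((abelianVarietyCohomologyExteriorH1_holds.equiv A 2).symm h)) ^ m) +
            (-1 : ℂ) ^ n •
              ((⋀[ℂ]^(2 * n) (complexBetti A.X 1)).subtype ((abelianVarietyCohomologyExteriorH1_holds.equiv A (2 * n)).symm cP) +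
                (⋀[ℂ]^(2 * n) (complexBetti A.X 1)).subtype ((abelianVarietyCohomologyExteriorH1_holds.equiv A (2 * n)).symm cQ))) *
          ((∑ m ∈ Finset.range (n + n + 1), ((Aₛ * la ^ m + Bₛ * mu ^ m) * ((m.factorial : ℕ) : ℂ)⁻¹) •
            ((⋀[ℂ]^2 (complexBetti A.X 1)).subtype ((abelianVarietyCohomologyExteriorH1_holds.equiv A 2).symm h)) ^ m) +
            (⋀[ℂ]^(2 * n) (complexBetti A.X 1)).subtype ((abelianVarietyCohomologyExteriorH1_holds.equiv A (2 * n)).symm cP) +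
            (⋀[ℂ]^(2 * n) (complexBetti A.X 1)).subtype ((abelianVarietyCohomologyExteriorH1_holds.equiv A (2 * n)).symm cQ))) =
      ((2 * (Aₛ * Bₛ * (la - mu) ^ (n + n)) + 2 * ((-1 : ℂ) ^ n * t)) * ((((n + n).factorial : ℕ) : ℂ)⁻¹)) •
        ((⋀[ℂ]^2 (complexBetti A.X 1)).subtype ((abelianVarietyCohomologyExteriorH1_holds.equiv A 2).symm h)) ^ (n + n) := by
  rw [proj_mukaiDual_mul_top_weilType hA hdim hd hφ hP hQ hp hh h11 hvol hcP hcP0 hcQ hcQ0 hn (fun m => Aₛ * la ^ m + Bₛ * mu ^ m) ht,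
    Mod4.mukaiP_twoSlope hn]

end RealCarrier

end Summit.Ventures.HSemireg.WeilFrame

end
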